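import Mathlib.FieldTheory.Galois.Basic
import Mathlib.Tactic.FieldSimp
import Mathlib.Tactic.FinCases
import Literature.Algebra.Homology.HeisenbergObstructionQuadratic
import Literature.NumberTheory.EllipticCurves.TwoTorsionGaloisActionProofs
import HarnessLib

/-!
# The level-`2` theta (Heisenberg) datum attached to three points of a line

Fix a field `L` with a monoid `G` acting by ring endomorphisms (`MulSemiringAction G L`; intended:
`L = K̄`, `G = Γ_K`), three DISTINCT elements `x₀, x₁, x₂ ∈ L` permuted by `G` through
`π : G → S₃` (`σ xᵢ = x_{π σ i}`), the `𝔽₂`-plane `V = ℤ/2 × ℤ/2` with its three nonzero vectors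
`v₀, v₁, v₂ = v₀ + v₁` (tree `DokchitserDokchitser2012.vec`) on which `G` acts additively with
`σ vᵢ = v_{π σ i}`, and SQUARE ROOTS `sᵢ ∈ L`, `sᵢ² = −Dᵢ`, `Dᵢ := (xᵢ − xⱼ)(xᵢ − xₖ)` (`{i,j,k} = {0,1,2}`).
Intended instance: `E[2] ≅ V` for an elliptic curve `E : y² + … ` with `2`-division cubic
`Ψ = 4(x − x₀)(x − x₁)(x − x₂)`, `Dᵢ = Ψ′(xᵢ)/4`.  This file CONSTRUCTS (structure `ThetaData` = the
input; everything else definitions with bodies and theorems):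

* `ThetaData.gmTable v w ∈ L` — the multiplication table of MUMFORD'S THETA GROUP `𝒢(𝓞(2·O))` at
  level `2` in the Galois-equivariant frame `u_T = (T, 1/(x − x_T))`:
  `u_T u_{T′} = (x_T − x_{T′})⁻¹ u_{T+T′}` (`T ≠ T′`), `u_T² = D_T⁻¹`, `u_O = 1`; PROVED: it is a
  normalized `2`-cocycle of `V` with values in `Lˣ` (`gmTable_cocycle`) and is `G`-equivariant
  (`smul_gmTable`); packaged as the `Gm`-valued Heisenberg datum `gmDatum : HeisenbergDatum G V (Additive Lˣ)`
  (tree `Literature/Algebra/Homology/HeisenbergObstructionCocycle.lean`) with `χ = 0`;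
* `ThetaData.thetaDatum` — its GAUGE by `λ(vᵢ) = sᵢ` (`v_T = s_T u_T`): the datum of the finite
  Heisenberg group `{±1, ±v₁, ±v₂, ±v₃} ≅ Q₈` with its (genuinely non-trivial) Galois action
  `σ v_T = ε_σ(T) v_{σT}`, `ε_σ(T) = σ(s_T)/s_{σT}`; PROVED: all its structure constants are `±1`
  (`toMul_m_sq`, `toMul_χ_sq`) and its commutator form is the perfect alternating pairing
  `e(v, w) = −1` for `v ≠ w` nonzero (`commForm_thetaDatum`), i.e. the Weil pairing on `E[2]`.

By `HeisenbergDatum.conn_gauge`, the obstruction cocycles of `thetaDatum` and `gmDatum` differ by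
the coboundary of `σ ↦ s_{ξ_σ}`; the former is `μ₂`-valued, the latter is explicitly split on Kummer
classes (sequel files) — together: the Poonen–Rains quadratic form `H¹(K, E[2]) → H²(K, μ₂)` and the
isotropy of Kummer images.

References: D. Mumford, *On the equations defining abelian varieties I*, Invent. Math. 1 (1966) §1
(theta groups; level-`2` structure); B. Poonen, E. Rains, *Random maximal isotropic subspaces and
Selmer groups*, JAMS 25 (2012) §4.1, Prop. 4.5 (the Heisenberg group `𝓗(𝓛)`, its commutator pairing
is the Weil pairing `e_λ`) [PoonenRains2012]; J. H. Silverman, *AEC* III.2.3 (translation by a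
`2`-torsion point: `(x(P) − e)(x(P+T) − e) = Ψ′(e)/4`, tree `TwoTorsionChordIdentities`) [SilvermanAEC2009].
No named fact is introduced.
-/

set_option autoImplicit false

noncomputable section

open scoped Classical

namespace Literature.NumberTheory.EllipticCurves

namespace ThetaLevelTwo

open Literature.Algebra.Homology
open Literature.NumberTheory.EllipticCurves.DokchitserDokchitser2012 (vec idx)

universe u v

/-- The `𝔽₂`-plane carrying the level-`2` theta datum (a frame of `E[2]`). [cite: PoonenRains2012, §4.1 (A[λ] for λ = 2)] -/
abbrev V : Type := ZMod 2 × ZMod 2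

/-- Every permutation of three letters is one of the six. [folklore] -/
private theorem perm_three_cases :
    ∀ g : Equiv.Perm (Fin 3), g = 1 ∨ g = Equiv.swap 0 1 ∨ g = Equiv.swap 0 2 ∨ g = Equiv.swap 1 2 ∨
      g = Equiv.swap 0 1 * Equiv.swap 0 2 ∨ g = Equiv.swap 0 2 * Equiv.swap 0 1 := by
  decide

/-- `idx` inverts `vec` on nonzero vectors. [folklore] -/
private theorem vec_idx : ∀ w : V, w ≠ 0 → vec (idx w) = w := by decide

/-- `idx (vec i) = i`. [folklore] -/
private theorem idx_vec : ∀ i : Fin 3, idx (vec i) = i := by decide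

/-- `vec i ≠ 0`. [folklore] -/
private theorem vec_ne_zero : ∀ i : Fin 3, vec i ≠ 0 := by decide

/-- `vec` is injective. [folklore] -/
private theorem vec_injective : Function.Injective vec := by decide

/-- **Input of the level-`2` theta datum**: an additive `G`-action `ρ` on `V = 𝔽₂²` and a ring action of
`G` on `L` intertwined by `π : G → S₃` (`σ vᵢ = v_{πσ i}`, `σ xᵢ = x_{πσ i}`), three distinct
`xᵢ ∈ L` (the abscissae of the nonzero `2`-torsion points) and square roots `sᵢ² = −(xᵢ − xᵢ₊₁)(xᵢ − xᵢ₊₂)`.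
[cite: PoonenRains2012, §4.1 and Prop. 4.5 (data of the Heisenberg group)] -/
structure ThetaData (G : Type u) (L : Type v) [Monoid G] [Field L] [MulSemiringAction G L] where
  /-- the action of `G` on the frame `V` -/
  ρ : G →* AddMonoid.End V
  /-- the induced permutation of the three nonzero vectors / roots -/
  π : G → Equiv.Perm (Fin 3)
  /-- the three roots `x₀, x₁, x₂` -/
  x : Fin 3 → L
  /-- square roots `sᵢ² = −Dᵢ` -/
  s : Fin 3 → L
  ρ_vec : ∀ (g : G) (i : Fin 3), ρ g (vec i) = vec (π g i)
  smul_x : ∀ (g : G) (i : Fin 3), g • x i = x (π g i)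
  x_injective : Function.Injective x
  s_sq : ∀ i : Fin 3, s i ^ 2 = -((x i - x (i + 1)) * (x i - x (i + 2)))

namespace ThetaData

variable {G : Type u} {L : Type v} [Monoid G] [Field L] [MulSemiringAction G L]
variable (Θ : ThetaData G L)

/-- `Dᵢ := (xᵢ − xᵢ₊₁)(xᵢ − xᵢ₊₂)` (`= Ψ′(xᵢ)/4` for the `2`-division cubic `Ψ = 4∏(x − xⱼ)`).
[cite: SilvermanAEC2009, III.2.3 (translation by a 2-torsion point)] -/
def D (i : Fin 3) : L := (Θ.x i - Θ.x (i + 1)) * (Θ.x i - Θ.x (i + 2))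

/-- `xᵢ − xⱼ ≠ 0` for `i ≠ j`. [cite: PoonenRains2012, §4.1 (A[2] has four points)] -/
theorem sub_ne_zero {i j : Fin 3} (h : i ≠ j) : Θ.x i - Θ.x j ≠ 0 :=
  _root_.sub_ne_zero.mpr (Θ.x_injective.ne h)

/-- `Dᵢ ≠ 0`. [cite: SilvermanAEC2009, III.2.3 (translation by a 2-torsion point)] -/
theorem D_ne_zero (i : Fin 3) : Θ.D i ≠ 0 := by
  refine mul_ne_zero (Θ.sub_ne_zero ?_) (Θ.sub_ne_zero ?_) <;> fin_cases i <;> decide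

/-- `sᵢ ≠ 0`. [cite: PoonenRains2012, §4.1 (the Heisenberg group)] -/
theorem s_ne_zero (i : Fin 3) : Θ.s i ≠ 0 := fun h => by
  have := Θ.s_sq i
  rw [h, zero_pow two_ne_zero, eq_comm, neg_eq_zero] at this
  exact Θ.D_ne_zero i this

/-- `σ(Dᵢ) = D_{πσ i}`: the `G`-action permutes the `Dᵢ` (as `{πσ(i+1), πσ(i+2)} = {πσ i + 1, πσ i + 2}`).
[cite: PoonenRains2012, §4.1 (functoriality of the Heisenberg group)] -/
theorem smul_D (g : G) (i : Fin 3) : g • Θ.D i = Θ.D (Θ.π g i) := by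
  simp only [D, smul_mul', smul_sub, Θ.smul_x]
  rcases perm_three_cases (Θ.π g) with h | h | h | h | h | h <;> rw [h] <;> fin_cases i <;>
    simp [Equiv.swap_apply_def] <;> ring

/-! ### Mumford's theta group at level `2`: the `Gm`-valued table -/

/-- **The multiplication table of the theta group** in the frame `u_T = (T, 1/(x − x_T))`:
`u_v u_w = gmTable v w · u_{v+w}` with `gmTable O w = gmTable v O = 1`, `gmTable v v = D_v⁻¹`,
`gmTable v w = (x_v − x_w)⁻¹` for `v ≠ w` nonzero (Mumford 1966 §1; the constants come from
`(x − x_T)(x∘τ_T − x_T) = D_T` and `(x∘τ_{T′} − x_T)(x − x_{T′}) = (x_{T′} − x_T)(x − x_{T+T′})`,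
Silverman III.2.3). [cite: PoonenRains2012, Prop. 4.5 (the Heisenberg group as a central extension)] -/
def gmTable (v w : V) : L :=
  if v = 0 ∨ w = 0 then 1 else if v = w then (Θ.D (idx v))⁻¹ else (Θ.x (idx v) - Θ.x (idx w))⁻¹

/-- The table entries are nonzero. [cite: PoonenRains2012, Prop. 4.5 (the Heisenberg group as a central extension)] -/
theorem gmTable_ne_zero (v w : V) : Θ.gmTable v w ≠ 0 := by
  unfold gmTable
  split_ifs with h1 h2
  · exact one_ne_zero
  · exact inv_ne_zero (Θ.D_ne_zero _)
  · refine inv_ne_zero (Θ.sub_ne_zero fun h => h2 ?_)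
    rw [not_or] at h1
    rw [← vec_idx v h1.1, ← vec_idx w h1.2, h]

/-- `gmTable O w = 1`. [cite: PoonenRains2012, Prop. 4.5 (the Heisenberg group as a central extension)] -/
@[simp] theorem gmTable_zero_left (w : V) : Θ.gmTable 0 w = 1 := by simp [gmTable]

/-- `gmTable v O = 1`. [cite: PoonenRains2012, Prop. 4.5 (the Heisenberg group as a central extension)] -/
@[simp] theorem gmTable_zero_right (v : V) : Θ.gmTable v 0 = 1 := by simp [gmTable]

/-- `gmTable vᵢ vᵢ = Dᵢ⁻¹`. [cite: PoonenRains2012, Prop. 4.5 (the Heisenberg group as a central extension)] -/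
theorem gmTable_vec_self (i : Fin 3) : Θ.gmTable (vec i) (vec i) = (Θ.D i)⁻¹ := by
  simp [gmTable, vec_ne_zero, idx_vec]

/-- `gmTable vᵢ vⱼ = (xᵢ − xⱼ)⁻¹` for `i ≠ j`. [cite: PoonenRains2012, Prop. 4.5 (the Heisenberg group as a central extension)] -/
theorem gmTable_vec_vec {i j : Fin 3} (h : i ≠ j) : Θ.gmTable (vec i) (vec j) = (Θ.x i - Θ.x j)⁻¹ := by
  simp [gmTable, vec_ne_zero, idx_vec, vec_injective.ne h]

/-- **The table is a `2`-cocycle of `V`** (associativity of the theta group):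
`M(a,b) M(a+b,c) = M(b,c) M(a,b+c)`. [cite: PoonenRains2012, Prop. 4.5 (a) (the Heisenberg group is a group scheme)] -/
theorem gmTable_cocycle (a b c : V) :
    Θ.gmTable a b * Θ.gmTable (a + b) c = Θ.gmTable b c * Θ.gmTable a (b + c) := by
  have h01 : Θ.x 0 - Θ.x 1 ≠ 0 := Θ.sub_ne_zero (by decide)
  have h02 : Θ.x 0 - Θ.x 2 ≠ 0 := Θ.sub_ne_zero (by decide)
  have h12 : Θ.x 1 - Θ.x 2 ≠ 0 := Θ.sub_ne_zero (by decide)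
  have h10 : Θ.x 1 - Θ.x 0 ≠ 0 := Θ.sub_ne_zero (by decide)
  have h20 : Θ.x 2 - Θ.x 0 ≠ 0 := Θ.sub_ne_zero (by decide)
  have h21 : Θ.x 2 - Θ.x 1 ≠ 0 := Θ.sub_ne_zero (by decide)
  fin_cases a <;> fin_cases b <;> fin_cases c <;>
    simp (config := { decide := true }) [gmTable, D, idx] <;> field_simp <;> ring

/-- **`G`-equivariance of the table**: `σ(M(v,w)) = M(σv, σw)` (the frame `u_T` is defined over
`K(x_T)` functorially in `T`). [cite: PoonenRains2012, §4.1 (functoriality of the Heisenberg group)] -/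
theorem smul_gmTable (g : G) (v w : V) : g • Θ.gmTable v w = Θ.gmTable (Θ.ρ g v) (Θ.ρ g w) := by
  by_cases hv : v = 0
  · subst hv; simp
  by_cases hw : w = 0
  · subst hw; simp
  obtain ⟨i, rfl⟩ : ∃ i, v = vec i := ⟨idx v, (vec_idx v hv).symm⟩
  obtain ⟨j, rfl⟩ : ∃ j, w = vec j := ⟨idx w, (vec_idx w hw).symm⟩
  rw [Θ.ρ_vec, Θ.ρ_vec]
  by_cases hij : i = j
  · subst hij
    rw [gmTable_vec_self, gmTable_vec_self, smul_inv'', smul_D]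
  · rw [gmTable_vec_vec Θ hij, gmTable_vec_vec Θ ((Θ.π g).injective.ne hij), smul_inv'', smul_sub,
      Θ.smul_x, Θ.smul_x]

/-! ### The `Gm`-valued Heisenberg datum -/

/-- The action of `G` on `Lˣ` (through its ring action on `L`), as additive endomorphisms of
`Additive Lˣ`. [cite: PoonenRains2012, §4.1 (Galois action on the Heisenberg group)] -/
def unitsAction (G : Type u) (L : Type v) [Monoid G] [Field L] [MulSemiringAction G L] :
    G →* AddMonoid.End (Additive Lˣ) where
  toFun g :=
    { toFun := fun u =>
        Additive.ofMul (Units.map (MulSemiringAction.toRingHom G L g : L →* L) (Additive.toMul u))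
      map_zero' := by simp
      map_add' := fun u u' => by simp }
  map_one' := by
    apply AddMonoidHom.ext
    intro u
    apply Additive.toMul.injective
    apply Units.ext
    show ((1 : G) • ((Additive.toMul u : Lˣ) : L)) = ((Additive.toMul u : Lˣ) : L)
    exact one_smul G _
  map_mul' g h := by
    apply AddMonoidHom.ext
    intro u
    apply Additive.toMul.injective
    apply Units.ext
    show ((g * h) • ((Additive.toMul u : Lˣ) : L)) = g • h • ((Additive.toMul u : Lˣ) : L)
    exact mul_smul g h _

/-- Unfolding `unitsAction` on values: `(σ·u : L) = σ • (u : L)`. [cite: PoonenRains2012, §4.1 (Galois action on the Heisenberg group)] -/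
@[simp] theorem coe_toMul_unitsAction (g : G) (u : Additive Lˣ) :
    ((Additive.toMul (unitsAction G L g u) : Lˣ) : L) = g • ((Additive.toMul u : Lˣ) : L) := rfl

/-- The table entries as units. [cite: PoonenRains2012, Prop. 4.5 (the Heisenberg group as a central extension)] -/
def gmUnit (v w : V) : Lˣ := Units.mk0 (Θ.gmTable v w) (Θ.gmTable_ne_zero v w)

/-- Value of `gmUnit`. [cite: PoonenRains2012, Prop. 4.5 (the Heisenberg group as a central extension)] -/
@[simp] theorem coe_gmUnit (v w : V) : (Θ.gmUnit v w : L) = Θ.gmTable v w := rfl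

/-- **The `Gm`-valued theta datum** `(ρ, Lˣ-action, M, χ = 0)`: Mumford's theta group of `𝓞(2·O)`
with the Galois-equivariant section `u_T`. [cite: PoonenRains2012, Prop. 4.5 (Heisenberg group: central extension of A[λ] by Gm)] -/
def gmDatum : HeisenbergDatum G V (Additive Lˣ) where
  ρ := Θ.ρ
  α := unitsAction G L
  m v w := Additive.ofMul (Θ.gmUnit v w)
  χ _ _ := 0
  m_zero_left w := by
    apply Additive.toMul.injective; apply Units.ext; simp
  m_zero_right v := by
    apply Additive.toMul.injective; apply Units.ext; simp
  m_cocycle a b c := by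
    apply Additive.toMul.injective; apply Units.ext
    simp only [toMul_add, toMul_ofMul, Units.val_mul, coe_gmUnit]
    exact Θ.gmTable_cocycle a b c
  smul_m g v w := by
    rw [add_zero, zero_add, zero_add]
    apply Additive.toMul.injective; apply Units.ext
    rw [coe_toMul_unitsAction]
    simp only [toMul_ofMul, coe_gmUnit]
    exact Θ.smul_gmTable g v w
  χ_mul _ _ _ := by simp

/-- `gmDatum.m` on values. [cite: PoonenRains2012, Prop. 4.5 (the Heisenberg group as a central extension)] -/
@[simp] theorem coe_toMul_gmDatum_m (v w : V) :
    ((Additive.toMul (Θ.gmDatum.m v w) : Lˣ) : L) = Θ.gmTable v w := rfl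

/-- `gmDatum.χ = 0` (the section `u_T` is Galois-equivariant). [cite: PoonenRains2012, §4.1 (functoriality of the Heisenberg group)] -/
@[simp] theorem gmDatum_χ (g : G) (v : V) : Θ.gmDatum.χ g v = 0 := rfl

/-- `gmDatum.ρ = ρ`. [cite: PoonenRains2012, §4.1 (A[λ])] -/
@[simp] theorem gmDatum_ρ : Θ.gmDatum.ρ = Θ.ρ := rfl

/-- `gmDatum.α` is the units action. [cite: PoonenRains2012, §4.1 (Galois action on the Heisenberg group)] -/
@[simp] theorem gmDatum_α : Θ.gmDatum.α = unitsAction G L := rfl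

/-! ### The gauge by the square roots `sᵢ`: the `μ₂`-valued theta datum -/

/-- The square roots as units: `sUnit O = 1`, `sUnit vᵢ = sᵢ`. [cite: PoonenRains2012, §4.1 (the Heisenberg group)] -/
def sUnit (v : V) : Lˣ := if v = 0 then 1 else Units.mk0 (Θ.s (idx v)) (Θ.s_ne_zero _)

/-- `sUnit O = 1`. [cite: PoonenRains2012, §4.1 (the Heisenberg group)] -/
@[simp] theorem sUnit_zero : Θ.sUnit 0 = 1 := by simp [sUnit]

/-- `sUnit vᵢ = sᵢ`. [cite: PoonenRains2012, §4.1 (the Heisenberg group)] -/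
@[simp] theorem coe_sUnit_vec (i : Fin 3) : (Θ.sUnit (vec i) : L) = Θ.s i := by
  simp [sUnit, vec_ne_zero, idx_vec]

/-- **The `μ₂`-valued theta datum** (values still written in `Lˣ`): the gauge of `gmDatum` by
`λ(v) = s_v`, i.e. the frame `v_T = s_T u_T` of the finite Heisenberg group `{±1, ±v_T} ≅ Q₈` with its
Galois action `σ v_T = (σ s_T / s_{σT}) v_{σT}`. [cite: PoonenRains2012, Prop. 4.5 and Cor. 4.6 (Heisenberg group and its connecting map)] -/
def thetaDatum : HeisenbergDatum G V (Additive Lˣ) :=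
  Θ.gmDatum.gauge (fun v => Additive.ofMul (Θ.sUnit v)) (by simp)

/-- `thetaDatum.ρ = ρ`. [cite: PoonenRains2012, §4.1 (A[λ])] -/
@[simp] theorem thetaDatum_ρ : Θ.thetaDatum.ρ = Θ.ρ := rfl

/-- `thetaDatum.α` is the units action. [cite: PoonenRains2012, §4.1 (Galois action on the Heisenberg group)] -/
@[simp] theorem thetaDatum_α : Θ.thetaDatum.α = unitsAction G L := rfl

/-- Structure constants of `thetaDatum`: `m(v,w) = M(v,w)·s_v·s_w / s_{v+w}` in `Lˣ`.
[cite: PoonenRains2012, Prop. 4.5 (the Heisenberg group as a central extension)] -/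
theorem toMul_thetaDatum_m (v w : V) :
    (Additive.toMul (Θ.thetaDatum.m v w) : Lˣ) = Θ.gmUnit v w * Θ.sUnit v * Θ.sUnit w / Θ.sUnit (v + w) := by
  simp only [thetaDatum, HeisenbergDatum.gauge_m, toMul_sub, toMul_add, toMul_ofMul]
  rfl

/-- Correction terms of `thetaDatum`: `χ_σ(v) = σ(s_v) / s_{σv}` in `Lˣ`.
[cite: PoonenRains2012, §4.1 (Galois action on the Heisenberg group)] -/
theorem toMul_thetaDatum_χ (g : G) (v : V) :
    (Additive.toMul (Θ.thetaDatum.χ g v) : Lˣ)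
      = Additive.toMul (unitsAction G L g (Additive.ofMul (Θ.sUnit v))) / Θ.sUnit (Θ.ρ g v) := by
  simp only [thetaDatum, HeisenbergDatum.gauge_χ, gmDatum_χ, gmDatum_α, gmDatum_ρ, zero_add, toMul_sub,
    toMul_ofMul]

/-- `(σ sᵢ)² = s_{πσ i}²` (both are `−D_{πσ i}`). [cite: PoonenRains2012, §4.1 (Galois action on the Heisenberg group)] -/
theorem smul_s_sq (g : G) (i : Fin 3) : (g • Θ.s i) ^ 2 = Θ.s (Θ.π g i) ^ 2 := by
  rw [show (g • Θ.s i) ^ 2 = g • (Θ.s i ^ 2) from (smul_pow' g (Θ.s i) 2).symm, Θ.s_sq, smul_neg,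
    Θ.s_sq]
  have := Θ.smul_D g i
  simp only [D] at this
  rw [this]

/-- **The correction terms are signs**: `χ_σ(v)² = 1`. [cite: PoonenRains2012, §4.1 (Galois action on the Heisenberg group)] -/
theorem toMul_thetaDatum_χ_sq (g : G) (v : V) : (Additive.toMul (Θ.thetaDatum.χ g v) : Lˣ) ^ 2 = 1 := by
  apply Units.ext
  rw [toMul_thetaDatum_χ, div_pow, Units.val_div_eq_div_val, Units.val_pow_eq_pow_val,
    Units.val_pow_eq_pow_val, coe_toMul_unitsAction, toMul_ofMul, Units.val_one]
  by_cases hv : v = 0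
  · subst hv
    simp
  · obtain ⟨i, rfl⟩ : ∃ i, v = vec i := ⟨idx v, (vec_idx v hv).symm⟩
    rw [Θ.ρ_vec, coe_sUnit_vec, coe_sUnit_vec, smul_s_sq]
    exact div_self (pow_ne_zero 2 (Θ.s_ne_zero _))

/-- `v + v = 0` in `V = 𝔽₂²`. [folklore] -/
private theorem add_self_V : ∀ v : V, v + v = 0 := by decide

/-- `vᵢ + vⱼ ≠ 0` for `i ≠ j`. [folklore] -/
private theorem vec_add_vec_ne_zero : ∀ i j : Fin 3, i ≠ j → vec i + vec j ≠ 0 := by decide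

/-- `Dᵢ Dⱼ = −(xᵢ − xⱼ)² D_k` when `vᵢ + vⱼ = v_k` (`{i, j, k} = {0, 1, 2}`).
[cite: SilvermanAEC2009, III.1 (the 2-division cubic)] -/
theorem D_mul_D {i j k : Fin 3} (h : vec i + vec j = vec k) :
    Θ.D i * Θ.D j = -((Θ.x i - Θ.x j) ^ 2 * Θ.D k) := by
  fin_cases i <;> fin_cases j <;> fin_cases k <;> simp (config := { decide := true }) [D] at h ⊢ <;> ring

/-- **`m(v, v) = −1`** for `v ≠ O` (`v_T² = s_T² u_T² = −D_T · D_T⁻¹`): the lifts of the nonzero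
`2`-torsion points have order `4` (the finite Heisenberg group is `Q₈`).
[cite: PoonenRains2012, Prop. 4.5 (the Heisenberg group at level 2)] -/
theorem coe_toMul_thetaDatum_m_vec_self (i : Fin 3) :
    ((Additive.toMul (Θ.thetaDatum.m (vec i) (vec i)) : Lˣ) : L) = -1 := by
  rw [toMul_thetaDatum_m, add_self_V, sUnit_zero, div_one, Units.val_mul, Units.val_mul, coe_gmUnit,
    gmTable_vec_self, coe_sUnit_vec]
  have hD := Θ.D_ne_zero i
  have hs := Θ.s_sq i
  rw [← D] at hs
  rw [mul_assoc, ← pow_two, hs]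
  field_simp

/-- For `i ≠ j` with `vᵢ + vⱼ = v_k`: `m(vᵢ, vⱼ) = sᵢ sⱼ / ((xᵢ − xⱼ) s_k)` in `L`.
[cite: PoonenRains2012, Prop. 4.5 (the Heisenberg group at level 2)] -/
theorem coe_toMul_thetaDatum_m_vec_vec {i j k : Fin 3} (hij : i ≠ j) (hk : vec i + vec j = vec k) :
    ((Additive.toMul (Θ.thetaDatum.m (vec i) (vec j)) : Lˣ) : L)
      = (Θ.x i - Θ.x j)⁻¹ * Θ.s i * Θ.s j / Θ.s k := by
  rw [toMul_thetaDatum_m, hk, Units.val_div_eq_div_val, Units.val_mul, Units.val_mul, coe_gmUnit,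
    gmTable_vec_vec Θ hij, coe_sUnit_vec, coe_sUnit_vec, coe_sUnit_vec]

/-- **The structure constants are signs**: `m(v,w)² = 1` — `m(O,w) = m(v,O) = 1`, `m(v,v) = −1`,
and for `v ≠ w` nonzero `(s_v s_w/((x_v − x_w) s_{v+w}))² = D_v D_w /(−(x_v − x_w)² D_{v+w}) = 1`.
[cite: PoonenRains2012, Prop. 4.5 (the Heisenberg group at level 2)] -/
theorem toMul_thetaDatum_m_sq (v w : V) : (Additive.toMul (Θ.thetaDatum.m v w) : Lˣ) ^ 2 = 1 := by
  by_cases hv : v = 0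
  · subst hv; rw [Θ.thetaDatum.m_zero_left]; simp
  by_cases hw : w = 0
  · subst hw; rw [Θ.thetaDatum.m_zero_right]; simp
  obtain ⟨i, rfl⟩ : ∃ i, v = vec i := ⟨idx v, (vec_idx v hv).symm⟩
  obtain ⟨j, rfl⟩ : ∃ j, w = vec j := ⟨idx w, (vec_idx w hw).symm⟩
  apply Units.ext
  rw [Units.val_pow_eq_pow_val, Units.val_one]
  by_cases hij : i = j
  · subst hij
    rw [coe_toMul_thetaDatum_m_vec_self]
    norm_num
  obtain ⟨k, hk⟩ : ∃ k, vec i + vec j = vec k :=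
    ⟨idx (vec i + vec j), (vec_idx _ (vec_add_vec_ne_zero i j hij)).symm⟩
  rw [Θ.coe_toMul_thetaDatum_m_vec_vec hij hk]
  have hsi := Θ.s_sq i
  have hsj := Θ.s_sq j
  have hsk := Θ.s_sq k
  rw [← D] at hsi hsj hsk
  have hDD := Θ.D_mul_D hk
  have hxi : Θ.x i - Θ.x j ≠ 0 := Θ.sub_ne_zero hij
  have hsk' := Θ.s_ne_zero k
  rw [div_pow, div_eq_one_iff_eq (pow_ne_zero 2 hsk'), mul_pow, mul_pow, inv_pow, hsi, hsj, hsk,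
    mul_assoc, inv_mul_eq_iff_eq_mul₀ (pow_ne_zero 2 hxi)]
  linear_combination hDD

end ThetaData

end ThetaLevelTwo

end Literature.NumberTheory.EllipticCurves
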